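import Summits.QuantumFields.BalabanUV.Beta.TubeZeroFreeEnds

/-!
# Beta / TubeZeroFreeExample — a WORKED INSTANCE of the THEOREM DB certificate format (non-vacuity witness of (F) + (W); d = 0, winding k = 1)
# (β sub-cell, BINDER-OWNERS row CAP-k, lineage `b2b-balaban-beta-an5`, gen 23; node BETA-an5-g23-THEOREM-DB, annex; journal CLAIM l.14161)

PURPOSE.  `TubeZeroFree.TubeHol.ne_zero_of_vertexTori` takes (F) zero-freeness on the vertex tori and (W) one `SliceWindingEq` per
coordinate and sign pattern, the latter delivered by `TubeZeroFreeEnds.sliceWindingEq_of_words` from two CLOSED COMPASS WORDS.  This annex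
instantiates the whole chain on the simplest winding multiplier — the character `G q = e^{i q₀}` on `ℂ¹` (`d = 0`), which winds ONCE along
both boundary lines — with EXPLICIT words (five segments, quarter-turn directions `−π, −π/2, 0, π/2, π`, net count `k = 1` on both lines),
so that the orientation/closure conventions of the format are exercised with a non-zero winding and every hypothesis shape of the chain is
shown satisfiable by `norm_num`-grade facts (`Real.cos_pos_of_mem_Ioo`).  It is a TEMPLATE for the engines' (W) emitters, not a statement
about the cell's `k₀`.

* `quarterWord_character`: the five-segment quarter-turn word is a `ClosedWord` of net count 1 for `u ↦ e^{−s} e^{iu}` (any height `s`).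
* `character_ne_zero_of_DB`: THEOREM DB applied end-to-end: `e^{i q₀} ≠ 0` on the tube `|Im q₀| ≤ a` — from (F) + the two words.

HONEST FRAMING.  A toy instance ([folklore]); no number of the β-function; NOT BetaPertH, NOT continuum, NOT Clay.  0 `sorry`, 0 cite tags.
-/

namespace Summit.QuantumFields.BalabanUV.Beta.TubeZeroFreeExample

open Complex Set
open Summit.QuantumFields.BalabanUV.Beta.PolyRegularAlgebra (character)
open Summit.QuantumFields.BalabanUV.Beta.TubeMaximumModulus
open Summit.QuantumFields.BalabanUV.Beta.WindingIncrement
open Summit.QuantumFields.BalabanUV.Beta.LoopIncrement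
open Summit.QuantumFields.BalabanUV.Beta.TubeZeroFreeEnds
open scoped Real

noncomputable section

/-- the character `q ↦ e^{i q₀}` on `ℂ¹`. [folklore] -/
def G₁ : (Fin (0 + 1) → ℂ) → ℂ := character fun _ => 1

/-- its slice in the (only) coordinate is `z ↦ e^{iz}`. [folklore] -/
theorem slice_G₁ (q : Fin 0 → ℂ) (z : ℂ) : slice G₁ 0 q z = cexp (I * z) := by
  simp [slice_apply, G₁, character]

/-- the boundary value at height `s`: `u ↦ e^{−s}·e^{iu}` as a complex exponential. [folklore] -/
theorem hEdge_G₁ (q : Fin 0 → ℂ) (s u : ℝ) : hEdge (slice G₁ 0 q) s u = cexp (-(s : ℂ) + u * I) := by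
  rw [hEdge_apply, slice_G₁]
  congr 1
  ring_nf
  rw [I_sq]; ring

/-- the rotated real part on a segment: `Re (e^{−iθ} · e^{−s + iu}) = e^{−s} cos (u − θ)`. [folklore] -/
theorem re_rot_G₁ (s u θ : ℝ) : (cexp (-(θ * I)) * cexp (-(s : ℂ) + u * I)).re = Real.exp (-s) * Real.cos (u - θ) := by
  rw [← Complex.exp_add, exp_re]
  congr 1
  · congr 1; simp
  · congr 1; simp; ring

/-- positivity of the rotated real part when `|u − θ| ≤ π/4`. [folklore] -/
theorem re_rot_G₁_pos {s u θ : ℝ} (h : |u - θ| ≤ π / 4) : 0 < (cexp (-(θ * I)) * cexp (-(s : ℂ) + u * I)).re := by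
  rw [re_rot_G₁]
  refine mul_pos (Real.exp_pos _) (Real.cos_pos_of_mem_Ioo ⟨?_, ?_⟩) <;>
    linarith [(abs_le.mp h).1, (abs_le.mp h).2, Real.pi_pos]

/-- THE QUARTER-TURN WORD: nodes `−π, −3π/4, −π/4, π/4, 3π/4, π` (5 segments). [folklore] -/
def xW : ℕ → ℝ
  | 0 => -π
  | 1 => -(3 * π / 4)
  | 2 => -(π / 4)
  | 3 => π / 4
  | 4 => 3 * π / 4
  | _ => π

/-- its directions `−π, −π/2, 0, π/2, π` (one per segment; net count ONE full turn). [folklore] -/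
def thetaW : ℕ → ℝ
  | 0 => -π
  | 1 => -(π / 2)
  | 2 => 0
  | 3 => π / 2
  | _ => π

/-- **THE QUARTER-TURN WORD IS A CLOSED WORD OF NET COUNT 1 for `u ↦ e^{−s} e^{iu}`** (any height `s`): monotone nodes from `−π` to `π`,
direction steps `π/2 < π`, on each segment `|u − θ_j| ≤ π/4` so the leaf fact holds, closure `θ 4 = θ 0 + 2π·1`. [folklore] -/
theorem quarterWord_character (q : Fin 0 → ℂ) (s : ℝ) : ClosedWord (hEdge (slice G₁ 0 q) s) 1 5 xW thetaW where
  pos := by norm_num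
  first := rfl
  last := rfl
  mono j hj := by
    interval_cases j <;> simp only [xW] <;> linarith [Real.pi_pos]
  step j hj := by
    have hj4 : j < 4 := by omega
    interval_cases j <;> simp only [thetaW] <;> rw [abs_lt] <;> constructor <;> linarith [Real.pi_pos]
  leaf j hj u hu := by
    rw [hEdge_G₁]
    refine re_rot_G₁_pos ?_
    interval_cases j <;> simp only [xW, thetaW, mem_Icc] at hu ⊢ <;> rw [abs_le] <;> constructor <;>
      linarith [hu.1, hu.2, Real.pi_pos]
  closed := by simp only [thetaW]; push_cast; ring

/-- **THEOREM DB END-TO-END ON THE TOY MULTIPLIER**: (F) `e^{iq₀} ≠ 0` on the two vertex circles and (W) the quarter-turn word on both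
boundary lines (same net count 1) ⟹ `e^{i q₀} ≠ 0` on the closed tube `|Im q₀| ≤ a` — by `TubeHol.ne_zero_of_vertexTori`, NOT by
`exp_ne_zero` (which of course also proves it): the point is that every hypothesis of the certificate chain is instantiated. [folklore] -/
theorem character_ne_zero_of_DB {a : ℝ} (ha : 0 < a) : ∀ p ∈ Tube (fun _ : Fin (0 + 1) => a), G₁ p ≠ 0 := by
  have hG : TubeHol G₁ (fun _ => a) := tubeHol_character _ _
  refine hG.ne_zero_of_vertexTori (fun _ => ha) (fun p _ => by simp [G₁, character]) fun i s _ => ?_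
  haveI : Subsingleton (Fin (0 + 1)) := inferInstanceAs (Subsingleton (Fin 1))
  obtain rfl : i = 0 := Subsingleton.elim i 0
  refine ⟨Fin.elim0, fun j => j.elim0, ?_⟩
  exact sliceWindingEq_of_words hG 0 (fun j => j.elim0) ha.le (quarterWord_character _ a) (quarterWord_character _ (-a))

end

end Summit.QuantumFields.BalabanUV.Beta.TubeZeroFreeExample
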